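import Literature.AnabelianGeometry.AbsoluteAnabelian.GaloisCyclotomeH2TwoTowers
import Literature.AnabelianGeometry.AbsoluteAnabelian.GaloisCyclotomeTateModule
import HarnessLib

/-!
# [AbsTopIII] Rmk. 3.2.1 at the `H²` level — the two-towers junction stated for the coefficient
# isomorphism OF RECORD `galCyclotomeIsoTateModule`

S. Mochizuki, *Topics in Absolute Anabelian Geometry III*, Rmk. 3.2.1 p. 73 / Cor. 1.10 (i)(a) p. 42 (kurims
render `url-5493eb38cbb7`).  The tree's coefficient comparison `μ_Ẑ(G_k) ≅ Ẑ(1) = lim_n μ_n(k̄)` OF RECORD is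
`galCyclotomeIsoTateModule k φ hφ` (`GaloisCyclotomeTateModule.lean`: a `TopRep` isomorphism, levels
`levelUnit`); `GaloisCyclotomeH2TwoTowers.lean` (abc-iut-w4-d045) re-built the same map as the bare morphism
`galCyclotomeToTateModule φ hφ` (levels `componentUnit` of `GaloisCyclotomeTower.lean`).  This proof-only file
IDENTIFIES the two spellings (`levelUnit_eq_componentUnit`, `galCyclotomeIsoTateModule_hom_eq`: definitional) and
restates the two-towers junction for the isomorphism of record, so that consumers (abc-iut-w6-d075
«P32i-H2ISOEQ-STD», abc-iut-L4-d3 «COR110ia-NAT-OPEN») cite ONE name: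
* `twoTateModuleEquiv_cohomologyMap_galCyclotomeIsoTateModule` — `H²` of the iso of record intertwines
  abc-iut-L4-t17's `galCyclotomeH2EquivPowCompatible` with abc-iut-L4-t11's `continuousCohomologyTwoTateModuleEquiv`;
* `toAdd_level_galH2EquivZhat_cohomologyMap_iso` / `MLFClosure.toAdd_level_galH2EquivZhat_cohomologyMap_iso` —
  the model `h2Iso` (`MLFClosure.galH2EquivZhat`, abc-iut-L4-t2) along `H²` of the iso of record has level-`n`
  residue `inv_n ∘ H²(cycProj_n)` for every `n ≥ 1`.
HONEST FRAMING: bookkeeping only (tree health: one notion, two names, identified); classical; nothing here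
bears on [IUTchIII] Cor. 3.12; no side taken.

## References
* [MochizukiAbsTopIII2015] S. Mochizuki, *Topics in Absolute Anabelian Geometry III*, Cor. 1.10 (i) p. 42,
  Rmk. 3.2.1 p. 73.
-/

noncomputable section

open CategoryTheory Function

universe u

namespace Literature.AnabelianGeometry.AbsoluteAnabelian

open Field
open Literature.NumberTheory.GaloisRepresentations
open Literature.NumberTheory.GaloisRepresentations.DiscreteGaloisModule
open Literature.AnabelianGeometry.EtaleTheta.ZHatLevel

section AnyField

variable (k : Type u) [Field k] [CharZero k]

variable (φ : muQZ (absoluteGaloisGroup k) ≃+ Additive (CommGroup.torsion (AlgebraicClosure k)ˣ))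
  (hφ : ∀ (σ : absoluteGaloisGroup k) (x : muQZ (absoluteGaloisGroup k)),
    (((Additive.toMul (φ (σ • x)) : CommGroup.torsion (AlgebraicClosure k)ˣ) :
        (AlgebraicClosure k)ˣ) : AlgebraicClosure k) =
      σ • (((Additive.toMul (φ x) : CommGroup.torsion (AlgebraicClosure k)ˣ) :
        (AlgebraicClosure k)ˣ) : AlgebraicClosure k))

/-- The two level readings coincide: `levelUnit k φ m n` (`GaloisCyclotomeTateModule.lean`) IS
`componentUnit φ n m` (`GaloisCyclotomeTower.lean`). [cite: MochizukiAbsTopIII2015, Cor 1.10 (i) p.42] -/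
theorem levelUnit_eq_componentUnit (m : MuZhatMod (absoluteGaloisGroup k)) (n : ℕ+) :
    levelUnit k φ m n = componentUnit φ n m := rfl

/-- The two maps `μ_Ẑ(G_k) → lim_n μ_n(k̄)` coincide on elements: `toTateModule k φ` (of record) and
`galCyclotomeToTateFun φ`. [cite: MochizukiAbsTopIII2015, Remark 3.2.1 p.73] -/
theorem toTateModule_eq_galCyclotomeToTateFun (m : MuZhatMod (absoluteGaloisGroup k)) :
    toTateModule k φ m = galCyclotomeToTateFun φ m :=
  Subtype.ext (funext fun n => muVal_injective k n rfl)

/-- **One notion**: the underlying morphism of the coefficient isomorphism OF RECORD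
`galCyclotomeIsoTateModule k φ hφ` is `galCyclotomeToTateModule φ hφ`.
[cite: MochizukiAbsTopIII2015, Remark 3.2.1 p.73] -/
theorem galCyclotomeIsoTateModule_hom_eq :
    (galCyclotomeIsoTateModule k φ hφ).hom = galCyclotomeToTateModule φ hφ :=
  TopRep.hom_ext (ContIntertwiningMap.ext (ContinuousLinearMap.ext fun m =>
    toTateModule_eq_galCyclotomeToTateFun k φ m))

/-- `H^q` of the iso of record, then `H^q(proj_n)`, is `H^q(cycProj_n)` (any degree, any universe; the
universe-`0`, degree-`2` instance is abc-iut-L4-d3's `Cor110Nat.cohomologyMap_projHom_galCyclotomeIsoTateModule`,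
`ReconstructionCor110NatResidueRestriction.lean`, proved there on cocycles).
[cite: MochizukiAbsTopIII2015, Remark 3.2.1 p.73] -/
theorem cohomologyMap_projHom_galCyclotomeIsoTateModule (n : ℕ+) (q : ℕ)
    (y : continuousCohomology q (galCyclotomeTopRep (absoluteGaloisGroup k))) :
    (cohomologyMap ((muSystem k).projHom n) q).hom
        ((cohomologyMap (galCyclotomeIsoTateModule k φ hφ).hom q).hom y) =
      (cohomologyMap (cycProj φ hφ n) q).hom y := by
  rw [galCyclotomeIsoTateModule_hom_eq]
  exact cohomologyMap_projHom_galCyclotomeToTateModule φ hφ n q y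

end AnyField

section MLF

variable (K : Type u) [Field K] [ValuativeRel K] [TopologicalSpace K] [IsNonarchimedeanLocalField K]
  [CharZero K]

variable (φ : muQZ (absoluteGaloisGroup K) ≃+ Additive (CommGroup.torsion (AlgebraicClosure K)ˣ))
  (hφ : ∀ (σ : absoluteGaloisGroup K) (x : muQZ (absoluteGaloisGroup K)),
    (((Additive.toMul (φ (σ • x)) : CommGroup.torsion (AlgebraicClosure K)ˣ) :
        (AlgebraicClosure K)ˣ) : AlgebraicClosure K) =
      σ • (((Additive.toMul (φ x) : CommGroup.torsion (AlgebraicClosure K)ˣ) :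
        (AlgebraicClosure K)ˣ) : AlgebraicClosure K))

/-- **`H²` of the iso of record intertwines the two tower equivalences.**
[cite: MochizukiAbsTopIII2015, Remark 3.2.1 p.73] -/
theorem twoTateModuleEquiv_cohomologyMap_galCyclotomeIsoTateModule
    (y : galCyclotomeH2 (absoluteGaloisGroup K)) :
    continuousCohomologyTwoTateModuleEquiv K
        ((cohomologyMap (galCyclotomeIsoTateModule K φ hφ).hom 2).hom y) =
      h2PowCompatibleEquivCohomologyLimit K (galCyclotomeH2EquivPowCompatible K φ hφ y) := by
  rw [galCyclotomeIsoTateModule_hom_eq]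
  exact twoTateModuleEquiv_cohomologyMap_galCyclotomeToTateModule K φ hφ y

/-- **The model `h2Iso` along `H²` of the iso of record has the residues of Cor. 1.10 (i)(a)'s chain**:
level `n` of `cohomologyLimitMuEquivZHat (continuousCohomologyTwoTateModuleEquiv (H²(i_φ) y))` is
`inv_n (H²(cycProj_n) y)`, every `n ≥ 1`. [cite: MochizukiAbsTopIII2015, Remark 3.2.1 p.73] -/
theorem toAdd_level_galH2EquivZhat_cohomologyMap_iso (y : galCyclotomeH2 (absoluteGaloisGroup K)) (n : ℕ+) :
    Multiplicative.toAdd (level n (Additive.toMul (cohomologyLimitMuEquivZHat K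
        (continuousCohomologyTwoTateModuleEquiv K
          ((cohomologyMap (galCyclotomeIsoTateModule K φ hφ).hom 2).hom y))))) =
      Prop121vii.invLevel K n ((cohomologyMap (cycProj φ hφ n) 2).hom y) := by
  rw [galCyclotomeIsoTateModule_hom_eq]
  exact toAdd_level_galH2EquivZhat_cohomologyMap K φ hφ y n

/-- The same against abc-iut-L4-t17's `limitClassesEquivZModChain` at the factorial levels.
[cite: MochizukiAbsTopIII2015, Remark 3.2.1 p.73] -/
theorem level_galH2EquivZhat_iso_eq_limitClassesEquivZModChain
    (y : galCyclotomeH2 (absoluteGaloisGroup K)) (i : ℕ) :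
    Multiplicative.toAdd (level (cycLevel i) (Additive.toMul (cohomologyLimitMuEquivZHat K
        (continuousCohomologyTwoTateModuleEquiv K
          ((cohomologyMap (galCyclotomeIsoTateModule K φ hφ).hom 2).hom y))))) =
      (limitClassesEquivZModChain K φ hφ
        ((galCyclotomeTower φ hφ).limitClassesEquiv (finite_H1_galCyclotomeTower K φ hφ) y)).1 i := by
  rw [galCyclotomeIsoTateModule_hom_eq]
  exact level_galH2EquivZhat_eq_limitClassesEquivZModChain K φ hφ y i

end MLF

section Model

variable (C : MLFClosure.{0})

variable (φ : muQZ (absoluteGaloisGroup C.k) ≃+ Additive (CommGroup.torsion (AlgebraicClosure C.k)ˣ))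
  (hφ : ∀ (σ : absoluteGaloisGroup C.k) (x : muQZ (absoluteGaloisGroup C.k)),
    (((Additive.toMul (φ (σ • x)) : CommGroup.torsion (AlgebraicClosure C.k)ˣ) :
        (AlgebraicClosure C.k)ˣ) : AlgebraicClosure C.k) =
      σ • (((Additive.toMul (φ x) : CommGroup.torsion (AlgebraicClosure C.k)ˣ) :
        (AlgebraicClosure C.k)ˣ) : AlgebraicClosure C.k))

/-- **Rmk. 3.2.1 at the `H²` level for the model Kummer theory of Prop. 3.2, iso of record**: the `h2Iso` of
abc-iut-L4-t2's all-slots-real model Kummer theory (`kummerTheoryStd_h2Iso = MLFClosure.galH2EquivZhat`) on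
`H²(galCyclotomeIsoTateModule) y` has level-`n` residue `inv_n (H²(cycProj_n) y)` for every `n ≥ 1`.
[cite: MochizukiAbsTopIII2015, Remark 3.2.1 p.73] -/
theorem MLFClosure.toAdd_level_galH2EquivZhat_cohomologyMap_iso (y : galCyclotomeH2 (absoluteGaloisGroup C.k))
    (n : ℕ+) :
    Multiplicative.toAdd (level n (Additive.toMul
        (C.galH2EquivZhat ((cohomologyMap (galCyclotomeIsoTateModule C.k φ hφ).hom 2).hom y)).down)) =
      Prop121vii.invLevel C.k n ((cohomologyMap (cycProj φ hφ n) 2).hom y) :=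
  Literature.AnabelianGeometry.AbsoluteAnabelian.toAdd_level_galH2EquivZhat_cohomologyMap_iso C.k φ hφ y n

end Model

end Literature.AnabelianGeometry.AbsoluteAnabelian

end
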